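import Summits.QuantumFields.BalabanUV.T4Continuum.Support.MinimalActionFinal
import HarnessLib

/-!
# T⁴ programme, node NE3 (η-rate of the minimisers) — THE ACTION SANDWICH, final assembly, part 3:
# THE ENDs FROM `ApproxRefine` WITH ARBITRARY CLOSED CONSTANTS + THE REGIME, AND THE LINEAR-BOUNDS THRESHOLD
# (the socket the crew's unconditional `approxRefine_sfClass` plugs into)

NE3 prover lineage P1, gen 18 (cell `pub-balaban`, unit `b2b-balaban-t4-ne3-p1`, `HOME/BINDER-OWNERS.md` row NE3 OWNER;
skeleton `t4/b2b-balaban-t4-ne3-p1/SKELETON-NE3-P1.md` v1.5).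

WHY THIS PART.  Parts 1–2 (`MinimalActionRegime` p213122, `MinimalActionFinal` p213453) take leaf R1 through its two filling
bounds (hfillS∕hfillG).  The crew has meanwhile closed leaf R1 OFF-TREE as ONE statement with NO configuration hypothesis —
`approxRefine_sfClass : … → ApproxRefine d (sfClass d L N ε) L N b c (B₁ b c) (C₁ b c) (M b c)` with `B₁, C₁, M` explicit
(long) polynomials in `(d, L, b, c)` (leaf-04 g2 RESULT journal l.9430, draft `ApproxRefineEnd`; filing = leaf-09 g2's part 3c
after row S4d's F4b–F4e clear the gate).  So the owner END should consume `ApproxRefine … b₁ c₁ m` for ARBITRARY `b₁ c₁ m ≥ 0`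
and ask only the regime — then the day `approxRefine_sfClass` lands, route (A) on B11 Thm 1 TYPE alone is a one-line
instantiation plus two polynomial bounds `B₁ b c ≤ K·t`, `M b c ≤ K·t` (part 4).  No new mathematics here.

CONTENT (0 def, 0 sorry):
§1 **`actionRate_sfClass_of_exists_approx`** — (H∃) + `ApproxRefine d (sfClass …) L N b c b₁ c₁ m` + (Rb) `2¹⁵(d+1)²(d+4)²L²b ≤ 1`,
   (Rr) `2¹⁰(d+1)(d+4)L²(b₁ + 8mL³/g) ≤ g`, (Rε) `2·max b (b₁ + 8mL³/g) ≤ ε` ⇒ `T4EtaRateMin.ActionRate (minActReadings d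
   (sfClass d L N ε) L N dom loc) (wallConstNA(d,L)(gradConst d (max c (c₁ + 36mL³/g)) + (max b (b₁ + 8mL³/g))³)/L²) (L⁻²)`
   (= `MinimalActionRateExists.actionRate_sfClass_of_exists_approxRefine` ∘ `MinimalActionRegime.sideConds_of_regime`);
   `exists_tendsto_minAct_of_exists_approx` (limit + geometric tail); `actionHalf_of_approx_sfClass₀` ((H3ˢᵘᵖ) twin, leaf-05's
   `actionHalf_of_approxRefine_sfClass₀` BY NAME).
§2 **`regime_of_linear_bounds`** (pure real arithmetic, core `linear_core`): if `b ≤ t`, `b₁ ≤ K·t`, `m ≤ K·t` (`K ≥ 1`) and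
   `2¹⁵(d+1)²(d+4)²L²·t ≤ 1`, `2¹⁴(d+1)(d+4)L^{2d+3}·K·t ≤ 1`, then (Rb), (Rr), and `2·max b (b₁ + 8mL³/g) ≤ 18·K·L^{d+2}·t`.
§3 **`actionRate_sfClass_of_exists_approx_linear`** — §1 ∘ §2: (H∃) + `ApproxRefine … b₁ c₁ m` + the linear bounds + the two
   thresholds + `18·K·L^{d+2}·t ≤ ε` ⇒ the same `ActionRate`.

HONEST FRAMING.  **NE3 is NOT proved**: (H∃)∕(H3ˢᵘᵖ) ([Balaban1985Variational] Thm 1 p. 279 TYPE, GLOBAL reading — journal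
l.9473) and `ApproxRefine` are hypotheses asserted for nothing here; the LOCAL half of `T4EtaRateMin.NE3Shape` is untouched;
spine PROVED count 0∕9.  No conditional of the cell (`BetaPertH`, (B), (B^μ), G-an2-4) occurs; nothing printed is a
hypothesis; shapes imported BY NAME; no `def`, no `sorry`, axioms ⊆ {propext, Classical.choice, Quot.sound}.  Finite T⁴ rung
(B)+1 — NOT infinite volume, NOT a mass gap, NOT the Clay problem, NOT summit progress.  PLACEMENT (human rule 2026-08-19):
`Summits/QuantumFields/BalabanUV/`.  HONEST DEPENDENCY (cell page 1): continuum YM on T⁴ ⇐ BetaPertH ∧ nine spine estimates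
(0/9 proved); BetaPertH ⇐ (D1) ∧ (D4) ∧ CAP+tail; G-an2-4 gates asym, D1 and NE2/3/4.
-/

set_option autoImplicit false

open scoped BigOperators Matrix Matrix.Norms.L2Operator Topology
open NormedSpace Filter

namespace Summit.QuantumFields.BalabanUV.T4Continuum.MinimalActionFinalApprox

open Literature.MathematicalPhysics.QuantumFieldTheory.Balaban1983to89
open B7Prop1Explicit B7Prop2Explicit
open T4AveragingDeficitWall hiding Site Plane Plaq Bond
open T4AveragingDeficitNonAbelian (wallConstNA)
open T4EtaRateMin (Readings ActionRate)
open MinimalActionSandwich MinimalActionRate MinimalActionRefine SmoothRefineOfApprox ChainEndFix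
open MinimalActionRateExists MinimalActionExistenceCapstone MinimalActionRegime

noncomputable section

variable {d : ℕ} {n : Type*} [Fintype n] [DecidableEq n] [Nonempty n]

/-! ## §1 The ENDs from `ApproxRefine` with arbitrary constants, under the regime -/

/-- **ROUTE (A)'s ACTION HALF FROM (H∃) AND `ApproxRefine`, UNDER THE REGIME.**  For `L, N ≥ 1`, `b, b₁, m ≥ 0` with
(Rb) `2¹⁵(d+1)²(d+4)²L²·b ≤ 1`, (Rr) `2¹⁰(d+1)(d+4)L²·(b₁ + 8mL³/g) ≤ g` (`g = gap d L`), (Rε) `2·max b (b₁ + 8mL³/g) ≤ ε`: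
(H∃) «every datum of `dom` has at every level SOME minimiser over `sfClass d L N ε` with sup-form regularity `(b, c)`»
([Balaban1985Variational] Thm 1 TYPE, a hypothesis) and `ApproxRefine d (sfClass …) L N b c b₁ c₁ m` (leaf R1) give
`ActionRate (minActReadings d (sfClass d L N ε) L N dom loc) (wallConstNA(d,L)(gradConst d (max c (c₁ + 36mL³/g)) +
(max b (b₁ + 8mL³/g))³)/L²) (L⁻²)` — `T4EtaRateMin.ActionRate` BY NAME.  NE3 is NOT proved by this. [folklore] -/
theorem actionRate_sfClass_of_exists_approx {L N : ℕ} (hL : 1 ≤ L) (hN : 1 ≤ N) {b c b₁ c₁ m ε : ℝ}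
    (hb : 0 ≤ b) (hb₁ : 0 ≤ b₁) (hm : 0 ≤ m)
    (hRb : 2 ^ 15 * ((d : ℝ) + 1) ^ 2 * ((d : ℝ) + 4) ^ 2 * (L : ℝ) ^ 2 * b ≤ 1)
    (hRr : 2 ^ 10 * ((d : ℝ) + 1) * ((d : ℝ) + 4) * (L : ℝ) ^ 2 * (b₁ + 8 * m * (L : ℝ) ^ 3 / gap d L) ≤ gap d L)
    (hRε : 2 * max b (b₁ + 8 * m * (L : ℝ) ^ 3 / gap d L) ≤ ε)
    {dom : Set (Site d → Fin d → (Matrix n n ℂ)ˣ)}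
    (hmin : ∀ V ∈ dom, ∀ k : ℕ, ∃ U, IsMinimiser d (sfClass d L N ε) L N k V U ∧ RegularSup d L N b c k U)
    (hA : ApproxRefine d (sfClass (n := n) d L N ε) L N b c b₁ c₁ m)
    {X : Type*} (loc : ℕ → (Site d → Fin d → (Matrix n n ℂ)ˣ) → X → ℝ) :
    ActionRate (minActReadings d (sfClass d L N ε) L N dom loc)
      (wallConstNA d L * (gradConst d (max c (c₁ + 36 * m * (L : ℝ) ^ 3 / gap d L))
        + (max b (b₁ + 8 * m * (L : ℝ) ^ 3 / gap d L)) ^ 3) / (L : ℝ) ^ 2) (((L : ℝ) ^ 2)⁻¹) := by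
  obtain ⟨hBs, hbε, hbs₁, hgap, hhalf, hε⟩ := sideConds_of_regime hL hb hb₁ hm hRb hRr hRε
  exact actionRate_sfClass_of_exists_approxRefine hL hN hb hb₁ hm hBs hbε hbs₁ hgap hhalf hε hmin hA loc

/-- The LIMIT form of `actionRate_sfClass_of_exists_approx` (`L ≥ 2`): `A_k(V) → A(V)` for every `V ∈ dom`, with the geometric
tail `|A_k(V) − A(V)| ≤ C·N^d·(L⁻²)^k/(1 − L⁻²)` (`T4EtaRateMin.ActionRate.exists_limit` BY NAME). [folklore] -/
theorem exists_tendsto_minAct_of_exists_approx {L N : ℕ} (hL : 2 ≤ L) (hN : 1 ≤ N) {b c b₁ c₁ m ε : ℝ}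
    (hb : 0 ≤ b) (hb₁ : 0 ≤ b₁) (hm : 0 ≤ m)
    (hRb : 2 ^ 15 * ((d : ℝ) + 1) ^ 2 * ((d : ℝ) + 4) ^ 2 * (L : ℝ) ^ 2 * b ≤ 1)
    (hRr : 2 ^ 10 * ((d : ℝ) + 1) * ((d : ℝ) + 4) * (L : ℝ) ^ 2 * (b₁ + 8 * m * (L : ℝ) ^ 3 / gap d L) ≤ gap d L)
    (hRε : 2 * max b (b₁ + 8 * m * (L : ℝ) ^ 3 / gap d L) ≤ ε)
    {dom : Set (Site d → Fin d → (Matrix n n ℂ)ˣ)}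
    (hmin : ∀ V ∈ dom, ∀ k : ℕ, ∃ U, IsMinimiser d (sfClass d L N ε) L N k V U ∧ RegularSup d L N b c k U)
    (hA : ApproxRefine d (sfClass (n := n) d L N ε) L N b c b₁ c₁ m)
    {V : Site d → Fin d → (Matrix n n ℂ)ˣ} (hV : V ∈ dom) :
    ∃ A : ℝ, Tendsto (fun k => minAct d (sfClass d L N ε) L N k V) atTop (𝓝 A) ∧
      ∀ k : ℕ, |minAct d (sfClass d L N ε) L N k V - A|
        ≤ wallConstNA d L * (gradConst d (max c (c₁ + 36 * m * (L : ℝ) ^ 3 / gap d L))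
            + (max b (b₁ + 8 * m * (L : ℝ) ^ 3 / gap d L)) ^ 3) / (L : ℝ) ^ 2 * (N : ℝ) ^ d
            * (((L : ℝ) ^ 2)⁻¹) ^ k / (1 - ((L : ℝ) ^ 2)⁻¹) :=
  (actionRate_sfClass_of_exists_approx (by omega) hN hb hb₁ hm hRb hRr hRε hmin hA
    (fun _ _ (_ : Unit) => (0 : ℝ))).exists_limit (rate_lt_one hL).2 hV

/-- **THE (H1)∕(H0)-FREE TWIN ON B11's DATA CLASS (7)** (leaf-05's `actionHalf_of_approxRefine_sfClass₀` BY NAME, under the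
regime): (H3ˢᵘᵖ) for the `sfClass`-minimisers of runs `k+1` + `ApproxRefine` + (Rb)(Rr)(Rε) + the averaging regime of the class
radius + `dom ⊆ sfClass d L N ε₁ 0` (`ε₁ ≤ 1/4`, `ε₁ ≤ b`, `4ε₁ ≤ c`) ⇒ `0 ≤ L⁻² < 1` and the same `ActionRate`. [folklore] -/
theorem actionHalf_of_approx_sfClass₀ {L N : ℕ} (hL : 2 ≤ L) (hN : 1 ≤ N) {b c b₁ c₁ m ε ε₁ : ℝ}
    (hb : 0 ≤ b) (hb₁ : 0 ≤ b₁) (hm : 0 ≤ m)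
    (hRb : 2 ^ 15 * ((d : ℝ) + 1) ^ 2 * ((d : ℝ) + 4) ^ 2 * (L : ℝ) ^ 2 * b ≤ 1)
    (hRr : 2 ^ 10 * ((d : ℝ) + 1) * ((d : ℝ) + 4) * (L : ℝ) ^ 2 * (b₁ + 8 * m * (L : ℝ) ^ 3 / gap d L) ≤ gap d L)
    (hRε : 2 * max b (b₁ + 8 * m * (L : ℝ) ^ 3 / gap d L) ≤ ε)
    (hε1 : 16 * C0 d * ε ≤ 3) (hε2 : 1024 * (d + 1) * (d + 4) * (L : ℝ) ^ 2 * ε ≤ 1)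
    (hε₁ : ε₁ ≤ 1 / 4) (hε₁b : ε₁ ≤ b) (hε₁c : 4 * ε₁ ≤ c)
    {dom : Set (Site d → Fin d → (Matrix n n ℂ)ˣ)} (hdom : dom ⊆ sfClass d L N ε₁ 0)
    (h3 : ∀ V ∈ dom, ∀ (k : ℕ) (U : Site d → Fin d → (Matrix n n ℂ)ˣ),
      IsMinimiser d (sfClass d L N ε) L N (k + 1) V U → RegularSup d L N b c (k + 1) U)
    (hA : ApproxRefine d (sfClass (n := n) d L N ε) L N b c b₁ c₁ m)
    {X : Type*} (loc : ℕ → (Site d → Fin d → (Matrix n n ℂ)ˣ) → X → ℝ) :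
    0 ≤ ((L : ℝ) ^ 2)⁻¹ ∧ ((L : ℝ) ^ 2)⁻¹ < 1 ∧
      ActionRate (minActReadings d (sfClass d L N ε) L N dom loc)
        (wallConstNA d L * (gradConst d (max c (c₁ + 36 * m * (L : ℝ) ^ 3 / gap d L))
          + (max b (b₁ + 8 * m * (L : ℝ) ^ 3 / gap d L)) ^ 3) / (L : ℝ) ^ 2) (((L : ℝ) ^ 2)⁻¹) := by
  obtain ⟨hBs, hbε, hbs₁, hgap, hhalf, hε⟩ := sideConds_of_regime (by omega) hb hb₁ hm hRb hRr hRε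
  exact actionHalf_of_approxRefine_sfClass₀ hL hN hb hb₁ hm hBs hbε hbs₁ hgap hhalf hε hε1 hε2 hε₁ hε₁b hε₁c hdom h3
    hA loc

/-! ## §2 The regime from LINEAR bounds on the refinement constants -/

/-- Pure-real core of `regime_of_linear_bounds` (atoms: `D1 = d+1`, `D4 = d+4`, `Lr = L`, `Ld = L^d`). [folklore] -/
theorem linear_core {D1 D4 Lr Ld t K b b₁ m : ℝ} (hD1 : 1 ≤ D1) (hD4 : 1 ≤ D4) (hLr : 1 ≤ Lr) (hLd : 1 ≤ Ld)
    (ht : 0 ≤ t) (hK : 1 ≤ K) (hbt : b ≤ t) (hb₁t : b₁ ≤ K * t)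
    (hmt : m ≤ K * t) (h1 : 2 ^ 15 * D1 ^ 2 * D4 ^ 2 * Lr ^ 2 * t ≤ 1)
    (h2 : 2 ^ 14 * D1 * D4 * (Ld ^ 2 * Lr ^ 3) * K * t ≤ 1) :
    2 ^ 15 * D1 ^ 2 * D4 ^ 2 * Lr ^ 2 * b ≤ 1 ∧
    2 ^ 10 * D1 * D4 * Lr ^ 2 * (b₁ + 8 * m * (Lr ^ 2 * Ld)) * Ld ≤ Lr ∧
    2 * max b (b₁ + 8 * m * (Lr ^ 2 * Ld)) ≤ 18 * K * (Lr ^ 2 * Ld) * t := by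
  have hLr2 : 1 ≤ Lr ^ 2 := one_le_pow₀ hLr
  have hLL : 1 ≤ Lr ^ 2 * Ld := one_le_mul_of_one_le_of_one_le hLr2 hLd
  have hKt : 0 ≤ K * t := by positivity
  refine ⟨?_, ?_, ?_⟩
  · have := mul_le_mul_of_nonneg_left hbt (by positivity : (0 : ℝ) ≤ 2 ^ 15 * D1 ^ 2 * D4 ^ 2 * Lr ^ 2)
    linarith
  · -- 2^10 D1 D4 Lr² Ld b₁ + 2^13 D1 D4 Lr⁴ Ld² m ≤ 9216 · D1 D4 Lr⁴ Ld² K t ≤ (9216/2^14) Lr ≤ Lr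
    have e : 2 ^ 10 * D1 * D4 * Lr ^ 2 * (b₁ + 8 * m * (Lr ^ 2 * Ld)) * Ld
        = 2 ^ 10 * (D1 * D4 * Lr ^ 2 * Ld * b₁) + 2 ^ 13 * (D1 * D4 * Lr ^ 4 * Ld ^ 2 * m) := by ring
    rw [e]
    have p0 : 0 ≤ D1 * D4 * Lr ^ 2 * Ld := by positivity
    have p1 : D1 * D4 * Lr ^ 2 * Ld * b₁ ≤ D1 * D4 * Lr ^ 2 * Ld * (K * t) := mul_le_mul_of_nonneg_left hb₁t p0
    have p2 : D1 * D4 * Lr ^ 2 * Ld * (K * t) * 1 ≤ D1 * D4 * Lr ^ 2 * Ld * (K * t) * (Lr ^ 2 * Ld) :=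
      mul_le_mul_of_nonneg_left hLL (by positivity)
    have p3 : D1 * D4 * Lr ^ 4 * Ld ^ 2 * m ≤ D1 * D4 * Lr ^ 4 * Ld ^ 2 * (K * t) :=
      mul_le_mul_of_nonneg_left hmt (by positivity)
    have p4 : D1 * D4 * Lr ^ 2 * Ld * (K * t) * (Lr ^ 2 * Ld) = D1 * D4 * Lr ^ 4 * Ld ^ 2 * (K * t) := by ring
    -- the master monomial
    have p5 : D1 * D4 * Lr ^ 4 * Ld ^ 2 * (K * t) = Lr * (D1 * D4 * (Ld ^ 2 * Lr ^ 3) * K * t) := by ring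
    have p6 : Lr * (D1 * D4 * (Ld ^ 2 * Lr ^ 3) * K * t) ≤ Lr * (1 / 2 ^ 14) :=
      mul_le_mul_of_nonneg_left (by linarith) (by linarith)
    linarith
  · have h1' : b ≤ 9 * K * (Lr ^ 2 * Ld) * t := by
      have : t ≤ K * (Lr ^ 2 * Ld) * t := by
        have hx : 1 ≤ K * (Lr ^ 2 * Ld) := one_le_mul_of_one_le_of_one_le hK hLL
        exact le_mul_of_one_le_left ht hx
      nlinarith
    have h2' : b₁ + 8 * m * (Lr ^ 2 * Ld) ≤ 9 * K * (Lr ^ 2 * Ld) * t := by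
      have q1 : b₁ ≤ K * t * (Lr ^ 2 * Ld) := by
        have := le_mul_of_one_le_right hKt hLL; linarith
      have q2 : 8 * m * (Lr ^ 2 * Ld) ≤ 8 * (K * t) * (Lr ^ 2 * Ld) := by
        have := mul_le_mul_of_nonneg_right hmt (by positivity : 0 ≤ Lr ^ 2 * Ld); linarith
      linarith
    have := max_le h1' h2'
    linarith

/-- **THE REGIME FROM LINEAR BOUNDS** (`d ≥ 1`, `L ≥ 1`): if `b ≤ t`, `b₁ ≤ K·t`, `m ≤ K·t` with `K ≥ 1`, and the two thresholds
`2¹⁵(d+1)²(d+4)²L²·t ≤ 1`, `2¹⁴(d+1)(d+4)L^{2d+3}·K·t ≤ 1` hold, then (Rb), (Rr) with these `b₁, m`, and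
`2·max b (b₁ + 8mL³/g) ≤ 18·K·L^{d+2}·t` (so (Rε) holds once `18·K·L^{d+2}·t ≤ ε`). [folklore] -/
theorem regime_of_linear_bounds (hd : 1 ≤ d) {L : ℕ} (hL : 1 ≤ L) {t K b b₁ m : ℝ} (ht : 0 ≤ t) (hK : 1 ≤ K)
    (hbt : b ≤ t) (hb₁t : b₁ ≤ K * t) (hmt : m ≤ K * t)
    (h1 : 2 ^ 15 * ((d : ℝ) + 1) ^ 2 * ((d : ℝ) + 4) ^ 2 * (L : ℝ) ^ 2 * t ≤ 1)
    (h2 : 2 ^ 14 * ((d : ℝ) + 1) * ((d : ℝ) + 4) * (L : ℝ) ^ (2 * d + 3) * K * t ≤ 1) :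
    2 ^ 15 * ((d : ℝ) + 1) ^ 2 * ((d : ℝ) + 4) ^ 2 * (L : ℝ) ^ 2 * b ≤ 1 ∧
    2 ^ 10 * ((d : ℝ) + 1) * ((d : ℝ) + 4) * (L : ℝ) ^ 2 * (b₁ + 8 * m * (L : ℝ) ^ 3 / gap d L) ≤ gap d L ∧
    2 * max b (b₁ + 8 * m * (L : ℝ) ^ 3 / gap d L) ≤ 18 * K * (L : ℝ) ^ (d + 2) * t := by
  have hL1 : (1 : ℝ) ≤ L := by exact_mod_cast hL
  have hL0 : (0 : ℝ) < L := by linarith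
  have hd0 : (0 : ℝ) ≤ d := Nat.cast_nonneg d
  have hD1 : (1 : ℝ) ≤ (d : ℝ) + 1 := by linarith
  have hD4 : (1 : ℝ) ≤ (d : ℝ) + 4 := by linarith
  have hLd : (1 : ℝ) ≤ (L : ℝ) ^ d := one_le_pow₀ hL1
  have hLd0 : (0 : ℝ) < (L : ℝ) ^ d := by positivity
  have hg : gap d L = (L : ℝ) / (L : ℝ) ^ d := gap_eq hL hd
  have e1 : (L : ℝ) ^ 3 / gap d L = (L : ℝ) ^ 2 * (L : ℝ) ^ d := by
    rw [hg, div_div_eq_mul_div, show (L : ℝ) ^ 3 * (L : ℝ) ^ d = (L : ℝ) ^ 2 * (L : ℝ) ^ d * L by ring,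
      mul_div_cancel_right₀ _ hL0.ne']
  have e2 : (L : ℝ) ^ (d + 2) = (L : ℝ) ^ 2 * (L : ℝ) ^ d := by rw [pow_add]; ring
  have e3 : (L : ℝ) ^ (2 * d + 3) = ((L : ℝ) ^ d) ^ 2 * (L : ℝ) ^ 3 := by rw [pow_add, pow_mul']
  rw [mul_div_assoc, e1, e2]
  rw [e3] at h2
  obtain ⟨c1, c2, c3⟩ := linear_core hD1 hD4 hL1 hLd ht hK hbt hb₁t hmt h1 h2
  refine ⟨c1, ?_, c3⟩
  rw [hg, le_div_iff₀ hLd0]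
  exact c2

/-! ## §3 The END from `ApproxRefine` with linear bounds on its constants -/

/-- **ROUTE (A)'s ACTION HALF FROM (H∃) + `ApproxRefine` WHOSE CONSTANTS ARE LINEARLY BOUNDED** — the socket for the crew's
unconditional `approxRefine_sfClass`: for `d ≥ 1`, `L, N ≥ 1`, if `ApproxRefine d (sfClass d L N ε) L N b c b₁ c₁ m` holds with
`0 ≤ b ≤ t`, `0 ≤ b₁ ≤ K·t`, `0 ≤ m ≤ K·t` (`K ≥ 1`), the thresholds `2¹⁵(d+1)²(d+4)²L²·t ≤ 1`, `2¹⁴(d+1)(d+4)L^{2d+3}·K·t ≤ 1`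
hold and `18·K·L^{d+2}·t ≤ ε`, then (H∃) gives `ActionRate (minActReadings d (sfClass d L N ε) L N dom loc) (…) (L⁻²)`.
NE3 is NOT proved by this. [folklore] -/
theorem actionRate_sfClass_of_exists_approx_linear (hd : 1 ≤ d) {L N : ℕ} (hL : 1 ≤ L) (hN : 1 ≤ N)
    {t K b c b₁ c₁ m ε : ℝ} (ht : 0 ≤ t) (hK : 1 ≤ K) (hb : 0 ≤ b) (hb₁ : 0 ≤ b₁) (hm : 0 ≤ m)
    (hbt : b ≤ t) (hb₁t : b₁ ≤ K * t) (hmt : m ≤ K * t)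
    (h1 : 2 ^ 15 * ((d : ℝ) + 1) ^ 2 * ((d : ℝ) + 4) ^ 2 * (L : ℝ) ^ 2 * t ≤ 1)
    (h2 : 2 ^ 14 * ((d : ℝ) + 1) * ((d : ℝ) + 4) * (L : ℝ) ^ (2 * d + 3) * K * t ≤ 1)
    (hεt : 18 * K * (L : ℝ) ^ (d + 2) * t ≤ ε)
    {dom : Set (Site d → Fin d → (Matrix n n ℂ)ˣ)}
    (hmin : ∀ V ∈ dom, ∀ k : ℕ, ∃ U, IsMinimiser d (sfClass d L N ε) L N k V U ∧ RegularSup d L N b c k U)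
    (hA : ApproxRefine d (sfClass (n := n) d L N ε) L N b c b₁ c₁ m)
    {X : Type*} (loc : ℕ → (Site d → Fin d → (Matrix n n ℂ)ˣ) → X → ℝ) :
    ActionRate (minActReadings d (sfClass d L N ε) L N dom loc)
      (wallConstNA d L * (gradConst d (max c (c₁ + 36 * m * (L : ℝ) ^ 3 / gap d L))
        + (max b (b₁ + 8 * m * (L : ℝ) ^ 3 / gap d L)) ^ 3) / (L : ℝ) ^ 2) (((L : ℝ) ^ 2)⁻¹) := by
  obtain ⟨hRb, hRr, hRε⟩ := regime_of_linear_bounds hd hL ht hK hbt hb₁t hmt h1 h2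
  exact actionRate_sfClass_of_exists_approx hL hN hb hb₁ hm hRb hRr (hRε.trans hεt) hmin hA loc

end

end Summit.QuantumFields.BalabanUV.T4Continuum.MinimalActionFinalApprox
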